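import Literature.Computability.Cryptography.HallgrenClassGroupRootSlots
import Literature.Computability.Complexity.CodeFPStringKit
import Literature.Computability.Complexity.CodeFPBudgets
import HarnessLib

/-!
# Root slots on codes

The typed `CodeFP` algebra for the maps of `HallgrenClassGroupRootSlots.lean`: the candidate list
(`candidatesC`), validity of a candidate (`validRootC`, divisibility tested as `(x / m) · m = x`), the
picked root (`pickRootC`, a `find?`), the slot root (`slotRootC`, Cipolla's `rootSearchC` behind the test
`q ∣ d`), the slot entry and **the slot list** (`slotEntryC`, `slotListC`: `dedup`, `count`, `zipWith`).
All maps are polynomial time in the binary/record codes of the brick algebra (Arora–Barak 2009, §1.3).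

## References

* S. Arora, B. Barak, *Computational Complexity: A Modern Approach*, CUP 2009, §1.3 [AroraBarak2009].
* H. Cohen, *A Course in Computational Algebraic Number Theory*, GTM 138, Springer 1993, §5.2
  [Cohen1993].
-/

namespace Literature.Computability.Cryptography.Hallgren2005

namespace RootSlots

open Cipolla FormComposition _root_.Computability Literature.Computability.Complexity
open Literature.Computability.Complexity.CodeFP

/-- Divisibility as an equation: `m ∣ x ↔ (x / m) · m = x`. [folklore] -/
theorem int_dvd_iff_ediv_mul_eq (m x : ℤ) : m ∣ x ↔ x / m * m = x :=
  ⟨fun h => Int.ediv_mul_cancel h, fun h => ⟨x / m, by rw [mul_comm]; exact h.symm⟩⟩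

/-- The candidate list on codes, from `(q, r)`. [cite: AroraBarak2009, §1.3] -/
theorem candidatesC : CodeFP (pairE natE (optE natE)) (rawE natE) (fun t => candidates t.1 t.2) := by
  -- the four lifts from `(q, u)`
  have hq : CodeFP (pairE natE natE) natE (fun s => s.1) := fst _ _
  have hu : CodeFP (pairE natE natE) natE (fun s => s.2) := snd _ _
  have hv := natMod.comp (hu.pair hq)
  have hw := natSub.comp (hq.pair hv)
  have hmn := natMin.comp (hv.pair hw)
  have hmx := natMax.comp (hv.pair hw)
  have h3 := natAdd.comp (hq.pair hmn)
  have h4 := natAdd.comp (hq.pair hmx)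
  have hl4 : CodeFP (pairE natE natE) (rawE natE) (fun s => [min (s.2 % s.1) (s.1 - s.2 % s.1),
      max (s.2 % s.1) (s.1 - s.2 % s.1), s.1 + min (s.2 % s.1) (s.1 - s.2 % s.1), s.1 + max (s.2 % s.1) (s.1 - s.2 % s.1)]) :=
    ((rawCons natE).comp (hmn.pair ((rawCons natE).comp (hmx.pair ((rawCons natE).comp (h3.pair
      ((rawSingleton natE).comp h4))))))).congr fun _ => rfl
  have hk := optCases (σ := ℕ) (eσ := natE) (eα := natE) (eδ := rawE natE)
    (k := fun q r => match r with
      | none => ([] : List ℕ)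
      | some u => [min (u % q) (q - u % q), max (u % q) (q - u % q), q + min (u % q) (q - u % q), q + max (u % q) (q - u % q)])
    (const natE ([] : List ℕ)) hl4 (fun _ => rfl) (fun _ _ => rfl)
  have hcond := natEq.comp ((fst natE (optE natE)).pair (const _ (2 : ℕ)))
  have h := ite hcond (const _ ([0, 1, 2, 3] : List ℕ)) hk
  refine h.congr fun t => ?_
  obtain ⟨q, _ | u⟩ := t <;> by_cases hc : q = 2 <;> simp [candidates, hc]

/-- Validity of a candidate on codes, from `(D, q, β)`. [cite: AroraBarak2009, §1.3] -/
theorem validRootC : CodeFP (pairE intE (pairE natE natE)) bitE (fun t => validRoot t.1 t.2.1 t.2.2) := by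
  have hD : CodeFP (pairE intE (pairE natE natE)) intE (fun t => t.1) := fst _ _
  have hq : CodeFP (pairE intE (pairE natE natE)) natE (fun t => t.2.1) := (snd _ _).fst'
  have hβ : CodeFP (pairE intE (pairE natE natE)) natE (fun t => t.2.2) := (snd _ _).snd'
  have hlt := natLt.comp (hβ.pair (natMul.comp ((const _ (2 : ℕ)).pair hq)))
  have hβi := intOfNat.comp hβ
  have hx := intSub.comp ((intMul.comp (hβi.pair hβi)).pair hD)
  have hm := intMul.comp ((const _ (4 : ℤ)).pair (intOfNat.comp hq))
  have hdv := intEq.comp ((intMul.comp ((intEDiv.comp (hx.pair hm)).pair hm)).pair hx)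
  refine (hlt.and hdv).congr fun t => ?_
  unfold validRoot
  congr 1
  rw [Bool.decide_congr ((int_dvd_iff_ediv_mul_eq _ _).trans (by rw [sq]))]

/-- The picked root on codes, from `(D, q, r)`. [cite: AroraBarak2009, §1.3] -/
theorem pickRootC : CodeFP (pairE intE (pairE natE (optE natE))) (optE natE) (fun t => pickRoot t.1 t.2.1 t.2.2) := by
  have hp : CodeFP (pairE (pairE intE natE) natE) bitE (fun s => validRoot s.1.1 s.1.2 s.2) :=
    validRootC.comp ((fst _ _).fst'.pair ((fst _ _).snd'.pair (snd _ _)))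
  have hf := rawFind? hp
  have hin : CodeFP (pairE intE (pairE natE (optE natE))) (pairE (pairE intE natE) (rawE natE))
      (fun t => ((t.1, t.2.1), candidates t.2.1 t.2.2)) :=
    ((fst _ _).pair (snd _ _).fst').pair (candidatesC.comp (snd _ _))
  exact (hf.comp hin).congr fun t => rfl

/-- The slot root on codes, from `(q, d, B)`. [cite: AroraBarak2009, §1.3] -/
theorem slotRootC : CodeFP (pairE natE (pairE natE (rawE strE))) (optE natE) (fun t => slotRoot t.1 t.2.1 t.2.2) := by
  have hq : CodeFP (pairE natE (pairE natE (rawE strE))) natE (fun t => t.1) := fst _ _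
  have hd : CodeFP (pairE natE (pairE natE (rawE strE))) natE (fun t => t.2.1) := (snd _ _).fst'
  have hB : CodeFP (pairE natE (pairE natE (rawE strE))) (rawE strE) (fun t => t.2.2) := (snd _ _).snd'
  have hdq := natMod.comp (hd.pair hq)
  have hcond := natEq.comp (hdq.pair (const _ (0 : ℕ)))
  have hn := natMod.comp ((natSub.comp (hq.pair hdq)).pair hq)
  have hs := rootSearchC.comp ((hq.pair hn).pair hB)
  have h := ite hcond (const _ (some 0 : Option ℕ)) hs
  refine h.congr fun t => ?_
  unfold slotRoot
  by_cases hc : t.2.1 % t.1 = 0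
  · rw [decide_eq_true hc, if_pos rfl, if_pos hc]
  · rw [decide_eq_false hc, if_neg Bool.false_ne_true, if_neg hc]

/-- The slot entry on codes: context `(d, F)`, item `(q, B)`. [cite: AroraBarak2009, §1.3] -/
theorem slotEntryC : CodeFP (pairE (pairE natE (rawE natE)) (pairE natE (rawE strE))) tripE
    (fun t => slotEntry t.1.1 t.1.2 t.2.1 t.2.2) := by
  have hd : CodeFP (pairE (pairE natE (rawE natE)) (pairE natE (rawE strE))) natE (fun t => t.1.1) := (fst _ _).fst'
  have hF : CodeFP (pairE (pairE natE (rawE natE)) (pairE natE (rawE strE))) (rawE natE) (fun t => t.1.2) := (fst _ _).snd'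
  have hq : CodeFP (pairE (pairE natE (rawE natE)) (pairE natE (rawE strE))) natE (fun t => t.2.1) := (snd _ _).fst'
  have hB : CodeFP (pairE (pairE natE (rawE natE)) (pairE natE (rawE strE))) (rawE strE) (fun t => t.2.2) := (snd _ _).snd'
  have hcnt := rawCountNat.comp (hq.pair hF)
  have hD := intNeg.comp (intOfNat.comp hd)
  have hsr := slotRootC.comp (hq.pair (hd.pair hB))
  have hpk := pickRootC.comp (hD.pair (hq.pair hsr))
  exact (hq.pair (hcnt.pair hpk)).congr fun t => rfl

/-- **The slot list on codes**, from `((d, F), Bs)`. [cite: AroraBarak2009, §1.3] -/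
theorem slotListC : CodeFP (pairE (pairE natE (rawE natE)) (rawE (rawE strE))) (rawE tripE)
    (fun t => slotList t.1.1 t.1.2 t.2) := by
  have hz := zipWith (σ := ℕ × List ℕ) (eσ := pairE natE (rawE natE)) (eα := natE) (eβ := rawE strE) (eγ := tripE)
    (g := fun s => slotEntry s.1.1 s.1.2 s.2.1 s.2.2) slotEntryC
  have hin : CodeFP (pairE (pairE natE (rawE natE)) (rawE (rawE strE)))
      (pairE (pairE natE (rawE natE)) (pairE (rawE natE) (rawE (rawE strE))))
      (fun t => (t.1, t.1.2.dedup, t.2)) :=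
    (fst _ _).pair (((dedup natE natE_injective).comp (fst _ _).snd').pair (snd _ _))
  exact (hz.comp hin).congr fun t => rfl

end RootSlots

end Literature.Computability.Cryptography.Hallgren2005
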